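import Summits.RiemannHypothesis.RiemannHypothesis.Theorems.HandoffEdgeEven
import Summits.RiemannHypothesis.RiemannHypothesis.Theorems.HandoffEdgeChebyshev
import HarnessLib
import Literature.NumberTheory.LFunctions.DusartShortIntervalPrimes

/-!
# HANDOFF, edge block: the parametric FULL reduction, and the EVEN half for every `q ≥ 10⁷` from Dusart's gap-ratio theorem (rh-explicit, track «HANDOFF», seat prove-2 gen2, ATTEMPT-6 §3–§4)

HONEST FRAMING. Nothing here bears on RH. Continuation of `HandoffEdgeEven.lean`:

* `edgeNonneg_of_gapIneq_param` — the FULL edge block `EdgeNonneg q q′ η` from the prime-gap inequality with the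
  PARAMETRIC lobe coercivity `lobeCoercivity (b − c′) K` in place of Theorem 12's `log(1/D) − log⁺log(1/D) − 8`
  (ATTEMPT-6 §4: the inequality then holds for every consecutive pair `1361 ≤ q ≤ 10⁷` by a sieve and on `(10⁷, 4·10¹⁸]`
  by the maximal-gap table — DERIVED, outside Lean; gen0's threshold with Theorem 12 was `2 010 733`) (PROVED).
* `Dusart2010_prop68` — NAMED FACT (Dusart 2010 Prop. 6.8: for `x ≥ 396 738` a prime in `(x, x(1 + 1/(25 ln² x))]`),
  a theorem in print, taken as a hypothesis.
* `edgeNonnegEven_of_dusart` — GIVEN that fact: for all consecutive primes `q < q′` with `q ≥ 10⁷` and every overlap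
  `0 < η ≤ 1/(4q)`, `EdgeNonnegEven q q′ η` (PROVED). Ingredients, all explicit: Dusart's gap RATIO makes the window
  short (`D ≤ 1/12000`), so the lobe energy at level `K = 2048` is `≥ 5.1·‖h₊‖²` (`lobeCoercivity_2048_ge`); the even
  cross constant is `≤ 4.24` (`handoffCrossConstEven_le_of_dusart`: caps `log q/√q ≤ 0.0054`, and the prime powers
  strictly inside the gap cost `Σ_{q<n<q′} Λ(n) ≤ 2.1√q`, `HandoffEdgeChebyshev.lean`). Together with the sieve of
  ATTEMPT-6 §3(i) (every consecutive pair `1361 ≤ q ≤ 10⁷`, DERIVED) this is the even half of the edge block for every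
  `q ≥ 1361`, with NO prime-gap conjecture and NO gap table; the odd half keeps the Cramér-order proviso of ATTEMPT-4.
-/

set_option linter.dupNamespace false

noncomputable section

open Complex Filter Set MeasureTheory Literature.NumberTheory.LFunctions
open scoped Real Topology ComplexConjugate ContDiff

namespace Summit.RiemannHypothesis.RiemannHypothesis.Theorems.Handoff

variable {h : ℝ → ℂ} {q q' : ℕ}

/-! ## §7 The FULL edge block with the parametric lobe coercivity (ATTEMPT-6 §4: q₀ drops from 2 010 733 to 1 361) -/

/-- **The edge block from the prime-gap inequality, parametric form.** For consecutive primes `q < q′`, an overlap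
`0 < η < min((log q)/2, (log 2)/2)`, and the inequality `handoffCrossConst q η b ≤ lobeCoercivity (b − c′) K_b` for some level
`K_b ≥ 2` at every `b` in the window (`c′ = (log q)/2 − η`): `EdgeNonneg q q′ η`. Same proof as `edgeNonneg_of_crossBound` with
Bombieri's Theorem-12 constant replaced by the parametric bound `re_weilQuadratic_lobe_ge_param`; ATTEMPT-6 §4: the inequality
holds for every consecutive pair `1361 ≤ q ≤ 10⁷` (sieve, DERIVED) and on `(10⁷, 4·10¹⁸]` by the maximal-gap table.
[this track, ATTEMPT-6 §4; cite: Bombieri2000, §12 eqs. (12.3)–(12.9) for the lobes] -/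
theorem edgeNonneg_of_gapIneq_param (hcons : ConsecutivePrimes q q') {η : ℝ} (hη : 0 < η)
    (hη' : η < Real.log q / 2) (hη2 : η < Real.log 2 / 2)
    (hgap : ∀ b ∈ Icc (Real.log q / 2) (Real.log q' / 2), ∃ K : ℝ, 2 ≤ K ∧
      handoffCrossConst q η b ≤ lobeCoercivity (b - (Real.log q / 2 - η)) K) :
    EdgeNonneg q q' η := by
  intro b hb h hh
  set c : ℝ := Real.log q / 2 - η with hc_def
  have hc : 0 < c := by rw [hc_def]; linarith
  have hq0 : (0 : ℝ) < q := by exact_mod_cast hcons.1.pos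
  have hwin : Real.log q' / 2 ≤ Real.log q / 2 + Real.log 2 / 2 := by
    have h2q : (q' : ℝ) ≤ 2 * q := by exact_mod_cast hcons.le_two_mul
    have hq'0 : (0 : ℝ) < q' := by exact_mod_cast hcons.2.1.pos
    have := Real.log_le_log hq'0 h2q
    rw [Real.log_mul (by norm_num) hq0.ne'] at this
    linarith
  have hcb : c < b := by rw [hc_def]; linarith [hb.1]
  have hlen : b - c ≤ Real.log 2 := by rw [hc_def]; linarith [hb.2]
  -- the lobes
  set hp := edgeLobeRight c h with hp_def
  set hm := edgeLobeLeft c h with hm_def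
  have hhp : IsWeilTest hp := isWeilTest_edgeLobeRight c hh.1
  have hhm : IsWeilTest hm := isWeilTest_edgeLobeLeft c hh.1
  have hcore : ∀ x : ℝ, |x| < c → h x = 0 := fun x hx ↦ hh.2.2 x (by rw [hc_def] at hx; exact hx)
  have hps : tsupport hp ⊆ Icc c b := tsupport_edgeLobeRight_subset hc hh.2.1 hcore
  have hms : tsupport hm ⊆ Icc (-b) (-c) := tsupport_edgeLobeLeft_subset hc hh.2.1 hcore
  -- self terms, parametric
  obtain ⟨K, hK, hXK⟩ := hgap b hb
  have hSp := re_weilQuadratic_lobe_ge_param hhp hcb hlen hps hK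
  have hSm : lobeCoercivity (b - c) K * ∫ t : ℝ, ‖hm t‖ ^ 2 ≤ (weilQuadratic hm).re := by
    have h1 : (-c) - (-b) = b - c := by ring
    have := re_weilQuadratic_lobe_ge_param hhm (by linarith : -b < -c) (by rw [h1]; exact hlen) hms hK
    rwa [h1] at this
  -- cross terms (the PROVED bound of HandoffCrossArch)
  have hXb := handoffCrossBound_holds (q' := q') hη.le hη' b hb hp hm hhp hhm
    (by rw [hc_def] at hps; exact hps) (by rw [hc_def] at hms; exact hms)
  -- assemble
  have hsum : h = hp + hm := (edgeLobeRight_add_edgeLobeLeft c h).symm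
  rw [hsum, weilQuadratic_add hhp hhm]
  simp only [Complex.add_re]
  have hnp : 0 ≤ ∫ t : ℝ, ‖hp t‖ ^ 2 := integral_nonneg fun _ ↦ by positivity
  have hnm : 0 ≤ ∫ t : ℝ, ‖hm t‖ ^ 2 := integral_nonneg fun _ ↦ by positivity
  have hcross := (abs_le.1 hXb).1
  rw [Complex.add_re, mul_add] at hcross
  have h1 := mul_le_mul_of_nonneg_right hXK hnp
  have h2 := mul_le_mul_of_nonneg_right hXK hnm
  linarith

/-! ## §8 The even half for EVERY `q ≥ 10⁷` from Dusart's gap-RATIO theorem (ATTEMPT-6 §3(ii)) -/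

/-- Dusart's theorem bounds the gap RATIO of consecutive primes: `q′ ≤ q(1 + 1/(25 log² q))` for `q ≥ 396 738`.
[cite: Dusart2010, Prop. 6.8] -/
theorem ConsecutivePrimes.cast_le_of_dusart (hD : Literature.NumberTheory.LFunctions.Dusart2010_prop68) (h : ConsecutivePrimes q q')
    (hq : (396738 : ℝ) ≤ q) : (q' : ℝ) ≤ q * (1 + 1 / (25 * Real.log q ^ 2)) := by
  obtain ⟨p, hp, hqp, hple⟩ := hD q hq
  have hqp' : q < p := by exact_mod_cast hqp
  have hle : q' ≤ p := h.2.2.2 p hp hqp'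
  calc (q' : ℝ) ≤ p := by exact_mod_cast hle
    _ ≤ _ := hple

/-! ### The even cross constant is small on the whole window -/

/-- `gapAtomSum` on the window is carried by `n ∈ [q, q′]`: for `0 < η ≤ 1/(4q)` the index range
`[⌈e^{2c′}⌉, ⌊e^{2b}⌋]` lies inside `[q, q′]`, so the sum is at most `Λ(q)/√q + Λ(q′)/√q′ + (Σ_{q<n<q′} Λ(n))/√q`.
[this track, ATTEMPT-6 §3(ii)] -/
theorem gapAtomSum_window_le (hcons : ConsecutivePrimes q q') {η b : ℝ} (hηq : η ≤ 1 / (4 * q))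
    (hb : b ∈ Icc (Real.log q / 2) (Real.log q' / 2)) :
    gapAtomSum (Real.log q / 2 - η) b ≤
      Real.log q / Real.sqrt q + Real.log q' / Real.sqrt q' +
        (∑ n ∈ Finset.Ioo q q', (ArithmeticFunction.vonMangoldt n : ℝ)) / Real.sqrt q := by
  have hq0 : (0 : ℝ) < q := by exact_mod_cast hcons.1.pos
  have hq1 : 1 ≤ q := hcons.1.pos
  have hlt : q < q' := hcons.2.2.1
  have hq'0 : (0 : ℝ) < q' := by exact_mod_cast hcons.2.1.pos
  set f : ℕ → ℝ := fun n ↦ (ArithmeticFunction.vonMangoldt n : ℝ) / Real.sqrt n with hf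
  have hf0 : ∀ n, 0 ≤ f n := fun n ↦ div_nonneg ArithmeticFunction.vonMangoldt_nonneg (Real.sqrt_nonneg _)
  -- the index range sits inside [q, q′]
  have hlow : q ≤ ⌈Real.exp (2 * (Real.log q / 2 - η))⌉₊ := by
    have hexp : Real.exp (2 * (Real.log q / 2 - η)) = q * Real.exp (-(2 * η)) := by
      rw [show 2 * (Real.log q / 2 - η) = Real.log q + -(2 * η) by ring, Real.exp_add, Real.exp_log hq0]
    have hge : (q : ℝ) - 1 < Real.exp (2 * (Real.log q / 2 - η)) := by
      rw [hexp]
      have h1 : -(2 * η) + 1 ≤ Real.exp (-(2 * η)) := Real.add_one_le_exp _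
      have h2 : 2 * η * q ≤ 1 / 2 := by
        rw [le_div_iff₀ (by positivity)] at hηq
        linarith
      nlinarith [h1, h2, hq0]
    have hlt' : q - 1 < ⌈Real.exp (2 * (Real.log q / 2 - η))⌉₊ := by
      rw [Nat.lt_ceil]
      have : ((q - 1 : ℕ) : ℝ) = (q : ℝ) - 1 := by
        rw [Nat.cast_sub hq1]; push_cast; ring
      rw [this]; exact hge
    omega
  have hhigh : ⌊Real.exp (2 * b)⌋₊ ≤ q' := by
    have : Real.exp (2 * b) ≤ q' := by
      have h1 : Real.exp (2 * b) ≤ Real.exp (Real.log q') := Real.exp_le_exp.2 (by linarith [hb.2])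
      rwa [Real.exp_log hq'0] at h1
    have h2 := Nat.floor_le_floor this
    rwa [Nat.floor_natCast] at h2
  have hsub : Finset.Icc ⌈Real.exp (2 * (Real.log q / 2 - η))⌉₊ ⌊Real.exp (2 * b)⌋₊ ⊆ Finset.Icc q q' := by
    intro n hn
    rw [Finset.mem_Icc] at hn ⊢
    exact ⟨hlow.trans hn.1, hn.2.trans hhigh⟩
  have hstep1 : gapAtomSum (Real.log q / 2 - η) b ≤ ∑ n ∈ Finset.Icc q q', f n := by
    unfold gapAtomSum
    exact Finset.sum_le_sum_of_subset_of_nonneg hsub (fun n _ _ ↦ hf0 n)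
  -- split off the endpoints
  have hsplit : ∑ n ∈ Finset.Icc q q', f n = f q + (f q' + ∑ n ∈ Finset.Ioo q q', f n) := by
    rw [Finset.Icc_eq_cons_Ioc hlt.le, Finset.sum_cons, Finset.Ioc_eq_cons_Ioo hlt, Finset.sum_cons]
  -- the endpoints are primes
  have hfq : f q = Real.log q / Real.sqrt q := by
    simp only [hf, ArithmeticFunction.vonMangoldt_apply_prime hcons.1]
  have hfq' : f q' = Real.log q' / Real.sqrt q' := by
    simp only [hf, ArithmeticFunction.vonMangoldt_apply_prime hcons.2.1]
  -- inside the gap `√n ≥ √q`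
  have hin : ∑ n ∈ Finset.Ioo q q', f n ≤
      (∑ n ∈ Finset.Ioo q q', (ArithmeticFunction.vonMangoldt n : ℝ)) / Real.sqrt q := by
    rw [Finset.sum_div]
    refine Finset.sum_le_sum fun n hn ↦ ?_
    rw [Finset.mem_Ioo] at hn
    have hqn : Real.sqrt q ≤ Real.sqrt n := Real.sqrt_le_sqrt (by exact_mod_cast hn.1.le)
    exact div_le_div_of_nonneg_left ArithmeticFunction.vonMangoldt_nonneg (Real.sqrt_pos.2 hq0) hqn
  rw [hsplit, hfq, hfq'] at hstep1
  linarith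

/-- **The even cross constant is uniformly small for `q ≥ 10⁷`** (given Dusart's gap ratio):
`handoffCrossConstEven q η b ≤ 4.24` on the whole window, for `0 < η ≤ 1/(4q)`. [this track, ATTEMPT-6 §3(ii)] -/
theorem handoffCrossConstEven_le_of_dusart (hD : Literature.NumberTheory.LFunctions.Dusart2010_prop68) (hcons : ConsecutivePrimes q q')
    (hq : (10 : ℝ) ^ 7 ≤ q) {η b : ℝ} (hη : 0 < η) (hηq : η ≤ 1 / (4 * q))
    (hb : b ∈ Icc (Real.log q / 2) (Real.log q' / 2)) :
    handoffCrossConstEven q η b ≤ 4.24 := by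
  have hq0 : (0 : ℝ) < q := by exact_mod_cast hcons.1.pos
  have hqq' : (q : ℝ) ≤ q' := by exact_mod_cast hcons.2.2.1.le
  have hq'0 : (0 : ℝ) < q' := hq0.trans_le hqq'
  have h16 : Real.exp 16 ≤ q := exp_sixteen_le.trans hq
  have h16' : Real.exp 16 ≤ q' := h16.trans hqq'
  have hlog16 : (16 : ℝ) ≤ Real.log q := by
    rw [Real.le_log_iff_exp_le hq0]; exact h16
  -- Dusart: q′ ≤ 1.001 q
  have hD' := ConsecutivePrimes.cast_le_of_dusart hD hcons (by linarith)
  have heps : 1 / (25 * Real.log q ^ 2) ≤ (1 : ℝ) / 6400 := by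
    rw [div_le_div_iff₀ (by positivity) (by norm_num)]
    nlinarith [hlog16]
  have hratio : (q' : ℝ) ≤ 1.001 * q := by nlinarith [hD', heps, hq0]
  -- the gap interior
  have hT := sum_Ioo_vonMangoldt_le hcons hq hratio
  -- caps
  have hcapq : Real.log q / Real.sqrt q ≤ 0.0054 := log_div_sqrt_le_of_exp_sixteen_le h16
  have hcapq' : Real.log q' / Real.sqrt q' ≤ 0.0054 := log_div_sqrt_le_of_exp_sixteen_le h16'
  have hG := gapAtomSum_window_le hcons hηq hb
  have hsq : 0 < Real.sqrt q := Real.sqrt_pos.2 hq0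
  have hTdiv : (∑ n ∈ Finset.Ioo q q', (ArithmeticFunction.vonMangoldt n : ℝ)) / Real.sqrt q ≤ 2.1 := by
    rw [div_le_iff₀ hsq]; linarith [hT]
  have hGap : gapAtomSum (Real.log q / 2 - η) b ≤ 2.1108 := by linarith [hG, hcapq, hcapq', hTdiv]
  -- the archimedean factor: c′ ≥ 7, M(c′) ≤ 0.002, D ≤ log 2
  set c' := Real.log q / 2 - η with hc'
  have hηsmall : η ≤ 0.001 := by
    have : (1 : ℝ) / (4 * q) ≤ 0.001 := by
      rw [div_le_iff₀ (by positivity)]; linarith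
    exact hηq.trans this
  have hc'7 : 7 ≤ c' := by rw [hc']; linarith
  have hM : archGapBound c' ≤ 0.002 := by
    unfold archGapBound
    have he : (1000 : ℝ) ≤ Real.exp c' := exp_seven_ge.trans (Real.exp_le_exp.2 hc'7)
    have hx : Real.exp (-(4 * c')) ≤ 1 / 2 := by
      have h1 : Real.exp (-(4 * c')) ≤ Real.exp (-1) := Real.exp_le_exp.2 (by linarith)
      have h2 := Real.exp_neg_one_lt_d9
      linarith
    have hden : (500 : ℝ) ≤ Real.exp c' * (1 - Real.exp (-(4 * c'))) := by nlinarith [he, hx, Real.exp_pos c']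
    rw [div_le_iff₀ (by linarith)]
    nlinarith [hden]
  have hD0 : 0 ≤ b - c' := by rw [hc']; linarith [hb.1]
  have hDle : b - c' ≤ 1 := by
    have h2q : (q' : ℝ) ≤ 2 * q := by exact_mod_cast hcons.le_two_mul
    have := Real.log_le_log hq'0 h2q
    rw [Real.log_mul (by norm_num) hq0.ne'] at this
    have hl2 := Real.log_two_lt_d9
    rw [hc']; linarith [hb.2]
  have hM0 : 0 ≤ archGapBound c' := (archGapBound_pos (by linarith)).le
  have hprod : archGapBound c' * (b - c') ≤ 0.002 * 1 := mul_le_mul hM hDle hD0 (by norm_num)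
  unfold handoffCrossConstEven
  rw [← hc']
  linarith [hprod, hGap]

/-! ### The lobe constant at level `K = 2048` -/

/-- `lobeCoercivity D 2048 ≥ 5.1` for `0 ≤ D ≤ 1/12000` (`L_2048 = 10 log 2 − 2⁻²¹ − π/4096 ≈ 6.9307`, `log π ≤ 1.1448`,
`2(sinh(D/2) − D/2) ≤ 0.0142`, `(2048·D/π)(L_2048 + 4.2275) ≤ 0.607`). [folklore; this track, ATTEMPT-6 §3(ii)] -/
theorem lobeCoercivity_2048_ge {D : ℝ} (hD0 : 0 ≤ D) (hD : D ≤ 1 / 12000) : (5.1 : ℝ) ≤ lobeCoercivity D 2048 := by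
  have hl2 := Real.log_two_gt_d9
  have hl2' := Real.log_two_lt_d9
  have hpi := Real.pi_gt_d6
  have hpi' := Real.pi_lt_d6
  have hlpi := Literature.Analysis.SpecialFunctions.Real.log_pi_le
  have hlog : Real.log ((2048 : ℝ) / 2) = 10 * Real.log 2 := by
    rw [show (2048 : ℝ) / 2 = 2 ^ 10 by norm_num, Real.log_pow]; norm_num
  have hs : 2 * (Real.sinh (D / 2) - D / 2) ≤ 0.0142 := two_mul_sinh_sub_le (by linarith)
  have hL : 6.9307 ≤ weilLevel 2048 ∧ weilLevel 2048 ≤ 6.9315 := by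
    unfold weilLevel
    rw [hlog]
    have h1 : π / (2 * 2048) ≤ 3.141593 / 4096 := by
      rw [div_le_div_iff₀ (by norm_num) (by norm_num)]; nlinarith
    have h2 : 0 ≤ π / (2 * 2048) := by positivity
    constructor <;> nlinarith
  have hfac : D * 2048 / π * (weilLevel 2048 + 4.22745354) ≤ 0.607 := by
    have h1 : D * 2048 / π ≤ (1 / 12000) * 2048 / 3.141592 := by
      rw [div_le_div_iff₀ Real.pi_pos (by norm_num)]
      nlinarith
    have h2 : 0 ≤ D * 2048 / π := by positivity
    have h3 : weilLevel 2048 + 4.22745354 ≤ 11.159 := by linarith [hL.2]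
    have h4 : 0 ≤ weilLevel 2048 + 4.22745354 := by linarith [hL.1]
    calc D * 2048 / π * (weilLevel 2048 + 4.22745354) ≤ ((1 / 12000) * 2048 / 3.141592) * 11.159 :=
          mul_le_mul h1 h3 h4 (by norm_num)
      _ ≤ 0.607 := by norm_num
  unfold lobeCoercivity
  linarith [hL.1, hfac, hs, hlpi]

/-! ### Assembly -/

/-- **The even half of the edge block for every `q ≥ 10⁷`, given Dusart's theorem.** For consecutive primes `q < q′`
with `10⁷ ≤ q` and an overlap `0 < η ≤ 1/(4q)`: `EdgeNonnegEven q q′ η`. The window is short by Dusart's gap-RATIO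
bound (`D ≤ 1/(50 log² q) + η ≤ 1/12000`), so the lobe energy at level `K = 2048` is `≥ 5.1·‖h₊‖²`, while the even
cross constant is `≤ 4.24` (caps `log q/√q ≤ 0.0054`, prime powers in the gap `≤ 2.1√q` by Chebyshev's `ψ − θ`).
With the sieve of ATTEMPT-6 §3(i) (every consecutive pair `1361 ≤ q ≤ 10⁷`, DERIVED, not a tree theorem) this is the
even half of the edge block for all `q ≥ 1361`. CONDITIONAL on the named fact `Dusart2010_prop68` (a theorem in print).
Nothing here bears on RH. [this track, ATTEMPT-6 §3(ii); cite: Dusart2010, Prop. 6.8; Bombieri2000, §12 eqs. (12.3)–(12.9)] -/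
theorem edgeNonnegEven_of_dusart (hD : Literature.NumberTheory.LFunctions.Dusart2010_prop68) (hcons : ConsecutivePrimes q q')
    (hq : (10 : ℝ) ^ 7 ≤ q) {η : ℝ} (hη : 0 < η) (hηq : η ≤ 1 / (4 * q)) :
    EdgeNonnegEven q q' η := by
  have hq0 : (0 : ℝ) < q := by exact_mod_cast hcons.1.pos
  have hqq' : (q : ℝ) ≤ q' := by exact_mod_cast hcons.2.2.1.le
  have hq'0 : (0 : ℝ) < q' := hq0.trans_le hqq'
  have h16 : Real.exp 16 ≤ q := exp_sixteen_le.trans hq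
  have hlog16 : (16 : ℝ) ≤ Real.log q := by
    rw [Real.le_log_iff_exp_le hq0]; exact h16
  have hηsmall : η ≤ 1 / (4 * 10 ^ 7) := by
    refine hηq.trans ?_
    exact div_le_div_of_nonneg_left (by norm_num) (by norm_num) (by linarith)
  have hη' : η < Real.log q / 2 := by linarith
  have hη2 : η < Real.log 2 / 2 := by
    have := Real.log_two_gt_d9; linarith
  refine edgeNonnegEven_of_ineq hcons hη hη' hη2 fun b hb ↦ ⟨2048, by norm_num, ?_⟩
  -- D = b − c′ ≤ 1/12000
  have hD' := ConsecutivePrimes.cast_le_of_dusart hD hcons (by linarith)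
  have heps : 1 / (25 * Real.log q ^ 2) ≤ (1 : ℝ) / 6400 := by
    rw [div_le_div_iff₀ (by positivity) (by norm_num)]
    nlinarith [hlog16]
  have hratio : (q' : ℝ) / q ≤ 1 + 1 / 6400 := by
    rw [div_le_iff₀ hq0]; nlinarith [hD', heps, hq0]
  have hlogdiff : Real.log q' - Real.log q ≤ 1 / 6400 := by
    rw [← Real.log_div hq'0.ne' hq0.ne']
    have := Real.log_le_sub_one_of_pos (div_pos hq'0 hq0)
    linarith
  have hD0 : 0 ≤ b - (Real.log q / 2 - η) := by linarith [hb.1]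
  have hDle : b - (Real.log q / 2 - η) ≤ 1 / 12000 := by linarith [hb.2]
  have hlobe := lobeCoercivity_2048_ge hD0 hDle
  have hX := handoffCrossConstEven_le_of_dusart hD hcons hq hη hηq hb
  linarith

/-- **For `q ≥ 10⁷` the edge block IS its odd half** (given Dusart's theorem): `EdgeNonneg q q′ η ↔ EdgeNonnegOdd q q′ η` for
`0 < η ≤ 1/(4q)` — the whole prime-gap content of the edge block sits in the odd sector (ATTEMPT-7: there it is of Cramér order).
[this track, ATTEMPT-6 §3, ATTEMPT-7 §4] -/
theorem edgeNonneg_iff_odd_of_dusart (hD : Literature.NumberTheory.LFunctions.Dusart2010_prop68) (hcons : ConsecutivePrimes q q')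
    (hq : (10 : ℝ) ^ 7 ≤ q) {η : ℝ} (hη : 0 < η) (hηq : η ≤ 1 / (4 * q)) :
    EdgeNonneg q q' η ↔ EdgeNonnegOdd q q' η := by
  rw [edgeNonneg_iff_even_and_odd]
  exact ⟨fun h ↦ h.2, fun h ↦ ⟨edgeNonnegEven_of_dusart hD hcons hq hη hηq, h⟩⟩

end Summit.RiemannHypothesis.RiemannHypothesis.Theorems.Handoff
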